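import Literature.Probability.Percolation.FKLoopNestingMeasureExistence
import Literature.Probability.LatticeModels.RandomClusterFKG
import HarnessLib

/-!
# The measure in DKLM Corollary 10: local probabilities, edge marginals, positive association

Companion of `Literature.Probability.Percolation.FKLoopNestingGaussianLimit` (the named fact
`dklm2026_corollary10`, Duminil-Copin–Kozlowski–Lammers–Manolescu, arXiv:2603.06268, Cor. 10) and
of `FKLoopNestingMeasureUnique` / `FKLoopNestingMeasureExistence` / `FKLoopNestingMeasureInvariance`
(the measure `P` in its hypothesis — a free infinite-volume random-cluster limit
`IsFreeRandomClusterLimit p q P` on `ℤ²`, Grimmett's `φ⁰_{p,q}` — exists, is unique and is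
`Aut(ℤ²)`-invariant). This file hooks `P` into the tree's finite-volume random-cluster library
(`Literature.Probability.LatticeModels.RandomCluster*`):

* `measureReal_eq_sum_cylinderEvent`, `tendsto_measureReal_of_isLocalEvent_of_tendsto` — a
  local event is the disjoint union of the cylinder events it contains
  (`DeterminedBy.eq_biUnion_localCylinder` of `PercolationEvents`, via
  `localCylinder_coe_eq_cylinderEvent`), so cylinder convergence with an identified limit gives
  convergence on every local event (Grimmett 2006, §4.1: the cylinder events are
  convergence-determining);
* `IsFreeRandomClusterLimit.tendsto_rcFreeBoxMeasure_real_preimage` — **`φ⁰_{Λ_n,p,q}(A) → φ⁰_{p,q}(A)`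
  for every local event `A`**, the box configuration being read on `ℤ²` with the pairs off the
  box closed (Grimmett 2006, Thm. (4.19)(a), (4.20) with `b = 0`);
* `IsFreeRandomClusterLimit.measureReal_setOf_mem_eq_freeEdgeDensity`,
  `… .boxFreeEdgeProb_le_measureReal` — **the one-edge marginal of `φ⁰_{p,q}` is the tree's free
  edge density `h⁰(p,q)`** (`LatticeModels.freeEdgeDensity`, the supremum = limit of the box
  densities `LatticeModels.boxFreeEdgeProb`; Grimmett 2006, (4.61));
* `rcFreeBoxMeasure_real_preimage_mono` / `_anti`,
  `IsFreeRandomClusterLimit.rcFreeBoxMeasure_real_le` / `… .le_rcFreeBoxMeasure_real` — the box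
  probabilities of an increasing (decreasing) event increase (decrease) with the box, Grimmett's
  (4.24), hence `φ⁰_{Λ_n,p,q}(A) ≤ φ⁰_{p,q}(A)` for increasing local `A` and every `n` (the first
  display in the proof of Thm. (4.19)(b)), and `≥` for decreasing `A`;
* `IsFreeRandomClusterLimit.mul_le_measureReal_inter` (both events increasing),
  `… _of_isLowerSet` (both decreasing), `IsFreeRandomClusterLimit.measureReal_inter_le_mul`
  (one of each), `IsFreeRandomClusterLimit.prod_le_measureReal_biInter` (finitely many
  increasing events) — **positive association of `φ⁰_{p,q}`, `q ≥ 1`, on local events**: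
  Grimmett 2006, Thm. (4.17)(c) (every limit random-cluster measure is positively associated)
  by Prop. (4.10)(b) (positive association survives weak limits) from the finite-volume FKG
  inequality Thm. (3.8) (`LatticeModels.rcMeasure_fkg_holds`).

Everything is proved; no named fact is introduced. Scope: Grimmett's positive association (4.8)
is stated for increasing continuous (equivalently, (4.9), semicontinuous) random variables; here
it is given for indicator functions of local monotone events, the form produced directly by
Prop. (4.10)(b) and used downstream (the extension to increasing limits of such events is
monotone convergence and is not spelled out).

## References

* G. Grimmett, *The Random-Cluster Model*, Springer 2006: §4.1 (4.8)–(4.10), Thm. (4.17)(c) and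
  its proof (p. 76), Thm. (4.19)(a)–(b) and its proof with eq. (4.24) (p. 78), (4.61).
  [Grimmett2006]
* C. M. Fortuin, P. W. Kasteleyn, J. Ginibre, Comm. Math. Phys. 22 (1971) 89–103 (FKG).
* H. Duminil-Copin, K. K. Kozlowski, P. Lammers, I. Manolescu, arXiv:2603.06268 (2026), Cor. 10
  (the measure `φ_{ℤ²,q}`). [DuminilCopinKozlowskiLammersManolescu2026]
-/

noncomputable section

open MeasureTheory Set Filter
open scoped Topology

namespace Literature.Probability.Percolation

open LatticeModels

/-! ### Local events are finite disjoint unions of cylinder events -/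

/-- The tree's cylinder `[S]_F` (`localCylinder`) over finite sets is the cylinder event
`cylinderEvent F S` (definitionally), so `DeterminedBy.eq_biUnion_localCylinder`
(`PercolationEvents`) writes a local event as the disjoint union of the cylinder events it
contains. [folklore] -/
theorem localCylinder_coe_eq_cylinderEvent (F S : Finset (Sym2 (Site 2))) :
    localCylinder (↑F : Set (Sym2 (Site 2))) (↑S : Set (Sym2 (Site 2))) = cylinderEvent F S :=
  Set.ext fun _ => Iff.rfl

open Classical in
/-- **The probability of a local event is the finite sum of the probabilities of the cylinder
events it contains** (a local event is their disjoint union,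
`DeterminedBy.eq_biUnion_localCylinder`). [cite: Grimmett2006, §4.1] -/
theorem measureReal_eq_sum_cylinderEvent (μ : Measure (BondConfig (Site 2))) [IsFiniteMeasure μ]
    {A : Set (BondConfig (Site 2))} {F : Finset (Sym2 (Site 2))}
    (hA : DeterminedBy A (↑F : Set (Sym2 (Site 2)))) :
    μ.real A = ∑ S ∈ F.powerset.filter (fun S : Finset (Sym2 (Site 2)) => (↑S : Set (Sym2 (Site 2))) ∈ A),
      μ.real (cylinderEvent F S) := by
  have hdisj : (↑(F.powerset.filter fun S : Finset (Sym2 (Site 2)) => (↑S : Set (Sym2 (Site 2))) ∈ A) :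
      Set (Finset (Sym2 (Site 2)))).PairwiseDisjoint fun S => cylinderEvent F S := by
    intro S hS S' hS' hne
    have hSF : S ⊆ F := Finset.mem_powerset.1 (Finset.mem_filter.1 hS).1
    have hS'F : S' ⊆ F := Finset.mem_powerset.1 (Finset.mem_filter.1 hS').1
    exact disjoint_cylinderEvent_of_ne hSF hS'F hne
  rw [← measureReal_biUnion_finset hdisj fun S _ => measurableSet_cylinderEvent F S]
  simp_rw [← localCylinder_coe_eq_cylinderEvent]
  exact congrArg μ.real hA.eq_biUnion_localCylinder

/-- **Cylinder convergence with an identified limit gives convergence on every local event**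
(for finite measures on the bond configurations of `ℤ²`): the cylinder events are
convergence-determining among local events. [cite: Grimmett2006, §4.1 and Thm. (4.19)(a), proof] -/
theorem tendsto_measureReal_of_isLocalEvent_of_tendsto (νs : ℕ → Measure (BondConfig (Site 2)))
    [∀ n, IsFiniteMeasure (νs n)] (μ : Measure (BondConfig (Site 2))) [IsFiniteMeasure μ]
    (h : ∀ E₀ S : Finset (Sym2 (Site 2)),
      Tendsto (fun n => (νs n).real (cylinderEvent E₀ S)) atTop (𝓝 (μ.real (cylinderEvent E₀ S))))
    {A : Set (BondConfig (Site 2))} (hA : IsLocalEvent A) :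
    Tendsto (fun n => (νs n).real A) atTop (𝓝 (μ.real A)) := by
  classical
  obtain ⟨F, hF⟩ := hA
  rw [measureReal_eq_sum_cylinderEvent μ hF]
  simp_rw [measureReal_eq_sum_cylinderEvent (νs _) hF]
  exact tendsto_finsetSum _ fun S _ => h F S

/-- The intersection of two local events is local. [folklore] -/
theorem IsLocalEvent.inter' {A B : Set (BondConfig (Site 2))} (hA : IsLocalEvent A)
    (hB : IsLocalEvent B) : IsLocalEvent (A ∩ B) := by
  classical
  obtain ⟨F, hF⟩ := hA
  obtain ⟨G, hG⟩ := hB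
  refine ⟨F ∪ G, (hF.mono ?_).inter (hG.mono ?_)⟩
  · simp only [Finset.coe_union, Set.subset_union_left]
  · simp only [Finset.coe_union, Set.subset_union_right]

/-! ### Box configurations read on `ℤ²` -/

/-- A pair is open in the lifted configuration iff the box configuration lies in the tree's
event `eOpen`. [cite: Grimmett2006, (4.61)] -/
theorem mem_image_val_iff_mem_eOpen {Λ : Finset (Site 2)} (ω : BondConfig ↥Λ)
    (e : Sym2 (Site 2)) :
    e ∈ (Sym2.map Subtype.val '' ω : BondConfig (Site 2)) ↔ ω ∈ eOpen Λ e := by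
  simp only [Set.mem_image, mem_eOpen_iff]

/-- Cylinder events pull back to the projected cylinder events of the box. [folklore] -/
theorem image_val_preimage_cylinderEvent (n : ℕ) (E₀ S : Finset (Sym2 (Site 2))) :
    (Set.image (Sym2.map Subtype.val) : BondConfig ↥(box 2 n) → BondConfig (Site 2)) ⁻¹'
        cylinderEvent E₀ S = pieceCylinderEvent (box 2 n) E₀ S := by
  ext ω
  simp only [Set.mem_preimage, mem_cylinderEvent_iff, mem_pieceCylinderEvent_iff, Set.mem_image]

/-- Restricting a configuration of the larger box to the smaller one and lifting gives a
sub-configuration of the lift. [folklore] -/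
theorem image_val_finsetRestrict_subset {m n : ℕ} (hmn : m ≤ n) (ω : BondConfig ↥(box 2 n)) :
    (Sym2.map Subtype.val '' (finsetRestrict (box_mono 2 hmn) ω) : BondConfig (Site 2)) ⊆
      Sym2.map Subtype.val '' ω := by
  rintro e ⟨e', he', rfl⟩
  refine ⟨edgeLift (box_mono 2 hmn) e', he', ?_⟩
  induction e' using Sym2.ind with
  | h a b => simp only [edgeLift_mk, Sym2.map_mk, finsetIncl_coe]

/-- The free box measures read on `ℤ²`: the probability of an event of `ℤ²`-configurations is
that of its pull-back. [folklore] -/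
theorem map_image_val_real_apply (p q : ℝ) (n : ℕ) {A : Set (BondConfig (Site 2))}
    (hA : MeasurableSet A) :
    ((rcFreeBoxMeasure p q n).map (Set.image (Sym2.map Subtype.val))).real A =
      (rcFreeBoxMeasure p q n).real (Set.image (Sym2.map Subtype.val) ⁻¹' A) :=
  map_measureReal_apply Measurable.of_discrete hA

/-! ### Local probabilities of the free limit are limits of free box probabilities -/

/-- **Grimmett 2006, Thm. (4.19)(a) / (4.20), `b = 0`, on `ℤ²`, for local events:** if `P` is
the free random-cluster limit `φ⁰_{p,q}` (`p ∈ [0,1]`, `q > 0`), then for every local event `A`,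
`φ⁰_{Λ_n,p,q}(A) → P(A)` as `n → ∞`, the box configuration being read on `ℤ²` with the pairs
off `Λ_n` closed. [cite: Grimmett2006, Thm. (4.19)(a)] -/
theorem IsFreeRandomClusterLimit.tendsto_rcFreeBoxMeasure_real_preimage {p q : ℝ}
    {P : Measure (BondConfig (Site 2))} (hP : IsFreeRandomClusterLimit p q P)
    (hp : p ∈ Set.Icc (0 : ℝ) 1) (hq : 0 < q) {A : Set (BondConfig (Site 2))}
    (hA : IsLocalEvent A) :
    Tendsto (fun n => (rcFreeBoxMeasure p q n).real (Set.image (Sym2.map Subtype.val) ⁻¹' A))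
      atTop (𝓝 (P.real A)) := by
  haveI := hP.isProbabilityMeasure
  haveI : ∀ n, IsProbabilityMeasure (rcFreeBoxMeasure p q n) := fun n =>
    isProbabilityMeasure_rcFreeBoxMeasure hp hq n
  haveI : ∀ n, IsProbabilityMeasure
      ((rcFreeBoxMeasure p q n).map (Set.image (Sym2.map Subtype.val))) := fun _ =>
    Measure.isProbabilityMeasure_map Measurable.of_discrete.aemeasurable
  have h := tendsto_measureReal_of_isLocalEvent_of_tendsto
    (fun n => (rcFreeBoxMeasure p q n).map (Set.image (Sym2.map Subtype.val))) P
    (fun E₀ S => ?_) hA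
  · refine h.congr fun n => ?_
    exact map_image_val_real_apply p q n (measurableSet_of_isLocalEvent_holds hA)
  · refine (hP.tendsto_cylinder E₀ S).congr fun n => ?_
    rw [map_image_val_real_apply p q n (measurableSet_cylinderEvent E₀ S),
      image_val_preimage_cylinderEvent]

/-! ### The one-edge marginal is the free edge density -/

/-- On a single pair the projected cylinder event "open" is the tree's `eOpen`. [folklore] -/
theorem pieceCylinderEvent_singleton_self (Λ : Finset (Site 2)) (e : Sym2 (Site 2)) :
    pieceCylinderEvent Λ {e} {e} = eOpen Λ e := by
  rw [pieceCylinderEvent_eq_iInter_eOpen Λ (Finset.Subset.refl _)]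
  simp only [Finset.mem_singleton, Set.iInter_iInter_eq_left]

/-- The free box probability that `e` is open is the tree's `boxFreeEdgeProb`. [cite: Grimmett2006, (4.61)] -/
theorem rcFreeBoxMeasure_real_pieceCylinderEvent_singleton (p q : ℝ) (e : Sym2 (Site 2)) (n : ℕ) :
    (rcFreeBoxMeasure p q n).real (pieceCylinderEvent (box 2 n) {e} {e}) =
      boxFreeEdgeProb 2 p q e n := by
  rw [pieceCylinderEvent_singleton_self]
  rfl

/-- **The one-edge marginal of `φ⁰_{p,q}` is the free edge density**: for `p ∈ [0,1]`, `q ≥ 1`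
and every pair `e`, `P(e open) = h⁰_{p,q}(e) = lim_N φ⁰_{Λ_N,p,q}(e open)`
(`LatticeModels.freeEdgeDensity`). [cite: Grimmett2006, (4.61) and Thm. (4.19)(a)] -/
theorem IsFreeRandomClusterLimit.measureReal_setOf_mem_eq_freeEdgeDensity {p q : ℝ}
    {P : Measure (BondConfig (Site 2))} (hP : IsFreeRandomClusterLimit p q P)
    (hp : p ∈ Set.Icc (0 : ℝ) 1) (hq : 1 ≤ q) (e : Sym2 (Site 2)) :
    P.real {ω | e ∈ ω} = freeEdgeDensity 2 p q e := by
  have h1 : Tendsto (fun n : ℕ => boxFreeEdgeProb 2 p q e n) atTop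
      (𝓝 (P.real (cylinderEvent {e} {e}))) :=
    (hP.tendsto_cylinder {e} {e}).congr fun n =>
      rcFreeBoxMeasure_real_pieceCylinderEvent_singleton p q e n
  rw [setOf_mem_eq_cylinderEvent]
  exact tendsto_nhds_unique h1 (tendsto_boxFreeEdgeProb hp hq e)

/-- In particular every free box density is a lower bound: `φ⁰_{Λ_N,p,q}(e open) ≤ P(e open)`
once `Λ_N ∋ e`. [cite: Grimmett2006, (4.24) and (4.61)] -/
theorem IsFreeRandomClusterLimit.boxFreeEdgeProb_le_measureReal {p q : ℝ}
    {P : Measure (BondConfig (Site 2))} (hP : IsFreeRandomClusterLimit p q P)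
    (hp : p ∈ Set.Icc (0 : ℝ) 1) (hq : 1 ≤ q) {e : Sym2 (Site 2)} {N : ℕ} (hN : pairRad e ≤ N) :
    boxFreeEdgeProb 2 p q e N ≤ P.real {ω | e ∈ ω} := by
  rw [hP.measureReal_setOf_mem_eq_freeEdgeDensity hp hq e]
  exact boxFreeEdgeProb_le_freeEdgeDensity hp (one_pos.trans_le hq) hN

/-! ### Box probabilities of monotone local events are monotone in the box -/

/-- **Grimmett's (4.24), read on `ℤ²`**: for `p ∈ [0,1]`, `q ≥ 1`, an increasing event `A` of
`ℤ²`-configurations and `m ≤ n`, `φ⁰_{Λ_m,p,q}(A) ≤ φ⁰_{Λ_n,p,q}(A)` (no locality needed: the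
restriction of a configuration of `Λ_n` to `Λ_m` lifts to a sub-configuration).
[cite: Grimmett2006, Thm. (4.19)(a), proof, eq. (4.24)] -/
theorem rcFreeBoxMeasure_real_preimage_mono {p q : ℝ} (hp : p ∈ Set.Icc (0 : ℝ) 1)
    (hq : 1 ≤ q) {A : Set (BondConfig (Site 2))} (hAu : IsUpperSet A) {m n : ℕ} (hmn : m ≤ n) :
    (rcFreeBoxMeasure p q m).real (Set.image (Sym2.map Subtype.val) ⁻¹' A) ≤
      (rcFreeBoxMeasure p q n).real (Set.image (Sym2.map Subtype.val) ⁻¹' A) := by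
  haveI := isProbabilityMeasure_rcFreeBoxMeasure hp (one_pos.trans_le hq) n
  calc (rcFreeBoxMeasure p q m).real (Set.image (Sym2.map Subtype.val) ⁻¹' A)
      ≤ (rcFreeBoxMeasure p q n).real
          (finsetRestrict (box_mono 2 hmn) ⁻¹' (Set.image (Sym2.map Subtype.val) ⁻¹' A)) :=
        rcMeasure_real_box_free_le_restrict hmn hp hq (hAu.preimage Set.monotone_image)
    _ ≤ (rcFreeBoxMeasure p q n).real (Set.image (Sym2.map Subtype.val) ⁻¹' A) :=
        measureReal_mono (fun ω hω => hAu (image_val_finsetRestrict_subset hmn ω) hω)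
          (measure_ne_top _ _)

/-- Complements inside a free box measure read on `ℤ²` (a probability measure on a finite
space: every event is measurable). [folklore] -/
theorem rcFreeBoxMeasure_real_preimage_compl {p q : ℝ} (hp : p ∈ Set.Icc (0 : ℝ) 1)
    (hq : 0 < q) (A : Set (BondConfig (Site 2))) (n : ℕ) :
    (rcFreeBoxMeasure p q n).real (Set.image (Sym2.map Subtype.val) ⁻¹' Aᶜ) =
      1 - (rcFreeBoxMeasure p q n).real (Set.image (Sym2.map Subtype.val) ⁻¹' A) := by
  haveI := isProbabilityMeasure_rcFreeBoxMeasure hp hq n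
  rw [Set.preimage_compl, probReal_compl_eq_one_sub (Set.toFinite _).measurableSet]

/-- The decreasing counterpart: `φ⁰_{Λ_n,p,q}(A) ≤ φ⁰_{Λ_m,p,q}(A)` for decreasing `A`, `m ≤ n`.
[cite: Grimmett2006, Thm. (4.19)(a), proof, eq. (4.24)] -/
theorem rcFreeBoxMeasure_real_preimage_anti {p q : ℝ} (hp : p ∈ Set.Icc (0 : ℝ) 1)
    (hq : 1 ≤ q) {A : Set (BondConfig (Site 2))} (hAl : IsLowerSet A) {m n : ℕ} (hmn : m ≤ n) :
    (rcFreeBoxMeasure p q n).real (Set.image (Sym2.map Subtype.val) ⁻¹' A) ≤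
      (rcFreeBoxMeasure p q m).real (Set.image (Sym2.map Subtype.val) ⁻¹' A) := by
  have hq0 : 0 < q := one_pos.trans_le hq
  have h := rcFreeBoxMeasure_real_preimage_mono hp hq hAl.compl hmn
  rw [rcFreeBoxMeasure_real_preimage_compl hp hq0 A m,
    rcFreeBoxMeasure_real_preimage_compl hp hq0 A n] at h
  linarith

/-- **`φ⁰_{Λ_n,p,q}(A) ≤ φ⁰_{p,q}(A)` for every increasing local event `A` and every box** —
the first display in Grimmett's proof of Thm. (4.19)(b) (`φ⁰_{p,q}(B) ≥ φ⁰_{Λ,p,q}(B)`): the box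
probabilities increase to their limit. [cite: Grimmett2006, Thm. (4.19)(b), proof] -/
theorem IsFreeRandomClusterLimit.rcFreeBoxMeasure_real_le {p q : ℝ}
    {P : Measure (BondConfig (Site 2))} (hP : IsFreeRandomClusterLimit p q P)
    (hp : p ∈ Set.Icc (0 : ℝ) 1) (hq : 1 ≤ q) {A : Set (BondConfig (Site 2))} (hA : IsLocalEvent A)
    (hAu : IsUpperSet A) (n : ℕ) :
    (rcFreeBoxMeasure p q n).real (Set.image (Sym2.map Subtype.val) ⁻¹' A) ≤ P.real A :=
  Monotone.ge_of_tendsto (fun _ _ hmn => rcFreeBoxMeasure_real_preimage_mono hp hq hAu hmn)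
    (hP.tendsto_rcFreeBoxMeasure_real_preimage hp (one_pos.trans_le hq) hA) n

/-- Dually, **`φ⁰_{p,q}(A) ≤ φ⁰_{Λ_n,p,q}(A)` for every decreasing local event `A` and every box**.
[cite: Grimmett2006, Thm. (4.19)(b), proof] -/
theorem IsFreeRandomClusterLimit.le_rcFreeBoxMeasure_real {p q : ℝ}
    {P : Measure (BondConfig (Site 2))} (hP : IsFreeRandomClusterLimit p q P)
    (hp : p ∈ Set.Icc (0 : ℝ) 1) (hq : 1 ≤ q) {A : Set (BondConfig (Site 2))} (hA : IsLocalEvent A)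
    (hAl : IsLowerSet A) (n : ℕ) :
    P.real A ≤ (rcFreeBoxMeasure p q n).real (Set.image (Sym2.map Subtype.val) ⁻¹' A) :=
  Antitone.le_of_tendsto (fun _ _ hmn => rcFreeBoxMeasure_real_preimage_anti hp hq hAl hmn)
    (hP.tendsto_rcFreeBoxMeasure_real_preimage hp (one_pos.trans_le hq) hA) n

/-! ### Positive association of the free limit (Grimmett 2006, Thm. (4.17)(c)) -/

/-- **Positive association of `φ⁰_{p,q}` on `ℤ²`, `q ≥ 1` (Grimmett 2006, Thm. (4.17)(c)), for
increasing local events:** `P(A) P(B) ≤ P(A ∩ B)`. Proof as printed: each free box measure is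
positively associated (the FKG inequality, Thm. (3.8) — the tree's `rcMeasure_fkg_holds` —
applied to the increasing pull-backs of `A`, `B` to the box), and positive association survives
the weak limit (Prop. (4.10)(b)), here through `tendsto_rcFreeBoxMeasure_real_preimage`.
[cite: Grimmett2006, Thm. (4.17)(c) with Prop. (4.10)(b) and Thm. (3.8)] -/
theorem IsFreeRandomClusterLimit.mul_le_measureReal_inter {p q : ℝ}
    {P : Measure (BondConfig (Site 2))} (hP : IsFreeRandomClusterLimit p q P)
    (hp : p ∈ Set.Icc (0 : ℝ) 1) (hq : 1 ≤ q) {A B : Set (BondConfig (Site 2))}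
    (hA : IsLocalEvent A) (hB : IsLocalEvent B) (hAu : IsUpperSet A) (hBu : IsUpperSet B) :
    P.real A * P.real B ≤ P.real (A ∩ B) := by
  have hq0 : 0 < q := one_pos.trans_le hq
  refine le_of_tendsto_of_tendsto'
    ((hP.tendsto_rcFreeBoxMeasure_real_preimage hp hq0 hA).mul
      (hP.tendsto_rcFreeBoxMeasure_real_preimage hp hq0 hB))
    (hP.tendsto_rcFreeBoxMeasure_real_preimage hp hq0 (hA.inter' hB)) fun n => ?_
  rw [Set.preimage_inter]
  exact rcMeasure_fkg_holds (finsetGraph (zdGraph 2) (box 2 n)) hp hq ∅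
    (hAu.preimage Set.monotone_image) (hBu.preimage Set.monotone_image)

/-- Positive association for two **decreasing** local events: `P(A) P(B) ≤ P(A ∩ B)`
(complements of increasing events). [cite: Grimmett2006, Thm. (4.17)(c)] -/
theorem IsFreeRandomClusterLimit.mul_le_measureReal_inter_of_isLowerSet {p q : ℝ}
    {P : Measure (BondConfig (Site 2))} (hP : IsFreeRandomClusterLimit p q P)
    (hp : p ∈ Set.Icc (0 : ℝ) 1) (hq : 1 ≤ q) {A B : Set (BondConfig (Site 2))}
    (hA : IsLocalEvent A) (hB : IsLocalEvent B) (hAl : IsLowerSet A) (hBl : IsLowerSet B) :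
    P.real A * P.real B ≤ P.real (A ∩ B) := by
  haveI := hP.isProbabilityMeasure
  have hAm : MeasurableSet A := measurableSet_of_isLocalEvent_holds hA
  have hBm : MeasurableSet B := measurableSet_of_isLocalEvent_holds hB
  have h := hP.mul_le_measureReal_inter hp hq hA.compl hB.compl hAl.compl hBl.compl
  have hu : P.real (A ∪ B) + P.real (A ∩ B) = P.real A + P.real B :=
    measureReal_union_add_inter hBm
  rw [probReal_compl_eq_one_sub hAm, probReal_compl_eq_one_sub hBm, ← Set.compl_union,
    probReal_compl_eq_one_sub (hAm.union hBm)] at h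
  nlinarith [h, hu]

/-- Positive association for one increasing and one decreasing local event:
`P(A ∩ B) ≤ P(A) P(B)`. [cite: Grimmett2006, Thm. (4.17)(c)] -/
theorem IsFreeRandomClusterLimit.measureReal_inter_le_mul {p q : ℝ}
    {P : Measure (BondConfig (Site 2))} (hP : IsFreeRandomClusterLimit p q P)
    (hp : p ∈ Set.Icc (0 : ℝ) 1) (hq : 1 ≤ q) {A B : Set (BondConfig (Site 2))}
    (hA : IsLocalEvent A) (hB : IsLocalEvent B) (hAu : IsUpperSet A) (hBl : IsLowerSet B) :
    P.real (A ∩ B) ≤ P.real A * P.real B := by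
  haveI := hP.isProbabilityMeasure
  have hBm : MeasurableSet B := measurableSet_of_isLocalEvent_holds hB
  have h := hP.mul_le_measureReal_inter hp hq hA hB.compl hAu hBl.compl
  have hd : P.real (A ∩ B) + P.real (A \ B) = P.real A := measureReal_inter_add_sdiff hBm
  rw [probReal_compl_eq_one_sub hBm, ← Set.sdiff_eq] at h
  nlinarith [h, hd]

/-- The intersection of finitely many local events is local. [folklore] -/
theorem isLocalEvent_biInter_finset {ι : Type*} (s : Finset ι)
    {A : ι → Set (BondConfig (Site 2))} (hA : ∀ i ∈ s, IsLocalEvent (A i)) :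
    IsLocalEvent (⋂ i ∈ s, A i) := by
  classical
  induction s using Finset.induction_on with
  | empty => simpa using isLocalEvent_univ
  | @insert a s ha ih =>
    rw [Finset.set_biInter_insert]
    exact (hA a (Finset.mem_insert_self a s)).inter'
      (ih fun i hi => hA i (Finset.mem_insert_of_mem hi))

/-- **Positive association for finitely many increasing local events**:
`∏ᵢ P(Aᵢ) ≤ P(⋂ᵢ Aᵢ)` (induction on the number of events). [cite: Grimmett2006, Thm. (4.17)(c)] -/
theorem IsFreeRandomClusterLimit.prod_le_measureReal_biInter {p q : ℝ}
    {P : Measure (BondConfig (Site 2))} (hP : IsFreeRandomClusterLimit p q P)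
    (hp : p ∈ Set.Icc (0 : ℝ) 1) (hq : 1 ≤ q) {ι : Type*} (s : Finset ι)
    {A : ι → Set (BondConfig (Site 2))} (hA : ∀ i ∈ s, IsLocalEvent (A i))
    (hAu : ∀ i ∈ s, IsUpperSet (A i)) :
    ∏ i ∈ s, P.real (A i) ≤ P.real (⋂ i ∈ s, A i) := by
  classical
  haveI := hP.isProbabilityMeasure
  induction s using Finset.induction_on with
  | empty => simp
  | @insert a s ha ih =>
    rw [Finset.prod_insert ha, Finset.set_biInter_insert]
    have hs : IsLocalEvent (⋂ i ∈ s, A i) :=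
      isLocalEvent_biInter_finset s fun i hi => hA i (Finset.mem_insert_of_mem hi)
    have hsu : IsUpperSet (⋂ i ∈ s, A i) :=
      isUpperSet_iInter₂ fun i hi => hAu i (Finset.mem_insert_of_mem hi)
    calc P.real (A a) * ∏ i ∈ s, P.real (A i)
        ≤ P.real (A a) * P.real (⋂ i ∈ s, A i) :=
          mul_le_mul_of_nonneg_left
            (ih (fun i hi => hA i (Finset.mem_insert_of_mem hi))
              fun i hi => hAu i (Finset.mem_insert_of_mem hi))
            measureReal_nonneg
      _ ≤ P.real (A a ∩ ⋂ i ∈ s, A i) :=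
          hP.mul_le_measureReal_inter hp hq (hA a (Finset.mem_insert_self a s)) hs
            (hAu a (Finset.mem_insert_self a s)) hsu

end Literature.Probability.Percolation

end
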